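/-
Copyright (c) 2026 the pub-hodgecm-mathlib formalisation cell (harness21).  Prover seat hodgecm-mathlib-LH7-p04 (g12), 2026-09-03.
Road M6 → F3 «TOT-Λ BY OVER-ORDERS» (LEAD F0P3a-plan (g16) T14-66; sigsheets SIG-F3-5 v1 6925585c ∕ SIG-F3-5b-III v1 5a0aa3cf, F3-5 pen by (α)-lineage), brick F3-5b-III-β «THE GATE AT A BLOCK FRAME».
-/
import Literature.NumberTheory.Automorphic.SelfDualStableLatticeCountOverOrders      -- ★-to-be F3-5b-III-α (this seat): `ncard_isSelfDualLattice_stable_eq_phiTHn ∕ _phiTHprimen` (gate binder `hgate` in integral currency)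
import Literature.NumberTheory.Automorphic.TypeTwoGateAtOverOrderGeneratorUniform    -- ★ (c8)-cor (F0P3a-p04 (g30)) p853170: `algHom_prod_apply_eq_blockFrame`, `quad_of_coord`; brings ★ (c5-i) `charpoly_blockFrame`, `reindex_fromBlocks_mulVec_single`, `frameVector_ne_zero`
import Literature.NumberTheory.Automorphic.ValuedFieldValuativeRelBridge              -- ★ `v_eq_one_iff_valuation_eq_one`, `v_lt_one_iff_valuation_lt_one`, `v_eq_iff_valuation_eq`
import HarnessLib

/-!
# The parity gate of the over-order strata, read at a block frame: from the F4 gate in `Valued`∕Krylov currency to ★ F3-5b-I's integral `Λ_O`-currency binder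

Topic `NumberTheory/Automorphic`; namespace `Literature.NumberTheory.Automorphic`.  THEOREMS ONLY (no definition, no instance, no notation, no named fact, no `sorry`).
Cell `pub/hodgecm-mathlib` (D-0151), crux H413 = `stmt-HodgeConjecture-24833`; road M6 → F3 «TOT-Λ by over-orders», brick **F3-5b-III-β** (SIG-F3-5b-III v1 §1 row `hgate`):
★ F3-5b-III-α counts the `τ`-stable self-dual lattices in the lattice-TREE currency modulo ONE binder `hgate` — ★ F3-5b-I's PARITY GATE at a deep unitary generator
`x′ = (u′, jO p′ + jO q′ θ)` of a glued over-order, in INTEGRAL letters (`u′, … ∈ 𝒪_E`, `u′ − 1 ∈ 𝔪`, `valuation`), in `Λ_O`-currency (`Λ_{incl 𝒪_E[x′]}(w)`), with parity `b % 2 = cls`.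
The ★ (c8) corollaries `gate_at_generator_uniform ∕ _wildUnit` (F0P3a-p04) deliver the same gate at a BLOCK FRAME `φ(g, u) = c·[g ⊕ u]·c⁻¹` in the F4 gate's letters: FIELD currency
(`u′, … : E`, `Valued.v (u′ − 1) < 1`, `Valued.v q′ = exp(−N″)`), KRYLOV currency (`⊕_k 𝒪·τ′^k w`, `τ′ = φ′ x′`), parity `Even (log |⟨x₀, x₀⟩_J| + b)` at the frame vector `x₀ = c·e₂`.
THIS FILE is the dictionary between the two (row-agnostic: the (c8) conclusion enters as the binder `hgateV`), and the resulting TREE-currency count at a block frame with NO gate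
binder in integral currency left.  (i) Integral → field: coercions along `hjO hσO′ hσKO`, `𝔪 = {v < 1}`, `valuation = v ϖ^N ⇒ Valued.v = exp(−N)`.  (ii) Krylov ↔ `Λ_O`: ★ F3-2a
`span_image_mulVec_eq_span_range_pow_mulVec_of_adjoin` with `𝒪[τ′] = φ′(incl 𝒪_E[x′])` (polynomial functoriality) and the integral characteristic polynomial `(X − u′)(X² − t′X + D′)` of
`τ′` (★ `algHom_prod_apply_eq_blockFrame` + ★ `charpoly_blockFrame`; the two quadratics of `λ′ ∉ E` agree).  (iii) Parity: `⟨x₀, x₀⟩ ≠ 0` (the `E`-line is `J`-orthogonal to the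
`K`-plane and `J` is invertible), `φ′(1,0)·w₀ = x₀` for the Krylov vector `w₀ = c(e₁ + e₂)`, and the CLASS DICTIONARY `(∃ c ≠ 0, |σ(c)c⟨x₀,x₀⟩| = 1) ⟺ Even (log|⟨x₀,x₀⟩|)`.
HONEST LABEL: HC_CM is proved only modulo the 2 remaining named inputs (hLiu418 24832, h413 24833) until rung 0 closes; dictionary algebra, asserts nothing printed; count-neutral
(pays no organ; zero label movement until F5 ★ and a desk-priced rider).

* §1 `exists_valuation_norm_mul_eq_one_iff_even_log` (class dictionary), `pairing_frameVector_ne_zero` (`⟨x₀,x₀⟩ ≠ 0`), `map_one_zero_mulVec_krylovVector` (`φ′(1,0)·w₀ = x₀`).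
* §2 `span_image_eq_span_range_pow_of_generator` (Krylov ↔ `Λ_O` at `τ′ = φ′(incl x′)`).
* §3 **`gate_integral_of_gate_valued`** (★ 5b-I's `hgate` from `hgateV`); §4 **`ncard_isSelfDualLattice_stable_eq_phiTHn_blockFrame ∕ _phiTHprimen_blockFrame`**.

## References
* [Rogawski1990] J. D. Rogawski, *Automorphic Representations of Unitary Groups in Three Variables*, Ann. of Math. Stud. 123 (1990): §4.9 Lemma 4.9.3 p. 56, Prop. 4.9.1 (b) p. 55.
* [Jacobowitz1962] R. Jacobowitz, *Hermitian forms over local fields*, Amer. J. Math. 84 (1962): §4, §7 Thm. 7.1.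
* [HornJohnson2013] R. A. Horn, C. R. Johnson, *Matrix Analysis*, 2nd ed. (2013): §1.3, §3.2.4 (block similarity; cyclic vectors and the commutant `E[τ]`).
* [SerreLocalFields1979] J.-P. Serre, *Local Fields*, GTM 67 (1979): Ch. V §2 (norm values at an unramified extension are the even powers).
-/

set_option autoImplicit false

noncomputable section

open Matrix Polynomial
open scoped MatrixGroups ValuativeRel Pointwise WithZero

namespace Literature.NumberTheory.Automorphic

open Literature.NumberTheory.Automorphic.UnitaryGroup ValuativeRel Literature.NumberTheory.Rogawski1990 Literature.NumberTheory.Rogawski1990.Flicker1998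
  Literature.NumberTheory.Automorphic.UnitaryLatticeTree Literature.NumberTheory.Automorphic.HermitianLattice Literature.NumberTheory.Automorphic.SymmetricEigenframe

/-! ## §1 The class dictionary, `⟨x₀, x₀⟩ ≠ 0`, and `φ′(1,0)·w₀ = x₀` -/

section Dictionary

variable {E : Type*} [Field E] [Valued E ℤᵐ⁰] [ValuativeRel E] [(Valued.v : Valuation E ℤᵐ⁰).Compatible]

/-- **THE CLASS DICTIONARY** (`σ` isometric, `|ϖ| = exp(−1)`): `∃ c ≠ 0, |σ(c)·c·d₀| = 1` iff `log |d₀|` is even — `|σ c| = |c|`, and `c := ϖ^k` for `log|d₀| = 2k`.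
[cite: SerreLocalFields1979, Ch. V §2] -/
theorem exists_valuation_norm_mul_eq_one_iff_even_log (σ : E →+* E) (hσv : ∀ x, Valued.v (σ x) = Valued.v x) {ϖ : E}
    (hϖ : Valued.v ϖ = WithZero.exp (-1 : ℤ)) {d₀ : E} (hd₀ : d₀ ≠ 0) :
    (∃ c : E, c ≠ 0 ∧ valuation E (σ c * c * d₀) = 1) ↔ Even (WithZero.log (Valued.v d₀)) := by
  have hϖ0 : ϖ ≠ 0 := fun h => by rw [h, map_zero] at hϖ; exact WithZero.exp_ne_zero hϖ.symm
  have hvd : Valued.v d₀ ≠ 0 := (Valuation.ne_zero_iff _).2 hd₀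
  constructor
  · rintro ⟨c, hc0, h1⟩
    rw [← v_eq_one_iff_valuation_eq_one, Valuation.map_mul, Valuation.map_mul, hσv] at h1
    have hvc : Valued.v c ≠ 0 := (Valuation.ne_zero_iff _).2 hc0
    have hlog : WithZero.log (Valued.v c) + WithZero.log (Valued.v c) + WithZero.log (Valued.v d₀) = 0 := by
      rw [← WithZero.log_mul hvc hvc, ← WithZero.log_mul (mul_ne_zero hvc hvc) hvd, h1, WithZero.log_one]
    exact ⟨-WithZero.log (Valued.v c), by omega⟩
  · rintro ⟨k, hk⟩
    refine ⟨ϖ ^ k, zpow_ne_zero k hϖ0, ?_⟩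
    rw [← v_eq_one_iff_valuation_eq_one, Valuation.map_mul, Valuation.map_mul, hσv, map_zpow₀, hϖ, ← WithZero.exp_log hvd, hk,
      ← WithZero.exp_zsmul, ← WithZero.exp_add, ← WithZero.exp_add, WithZero.exp_eq_one]
    simp only [smul_eq_mul, mul_neg, mul_one]
    ring

end Dictionary

section Frame

variable {E : Type*} [Field E] [ValuativeRel E] (σ : E →+* E) {K : Type*} [Field K] [Algebra E K] (σK : K →+* K)
  (J : GL (Fin 3) E)
  (τ : Matrix (Fin 3) (Fin 3) E) {w₀ : Fin 3 → E} (hK : IsUnit (Matrix.of fun i j : Fin 3 => ((τ ^ (j : ℕ)) *ᵥ w₀) i).det)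
  (φ : (E × K) →ₐ[E] Matrix (Fin 3) (Fin 3) E) (hφ : Function.Injective φ) (τB : E × K) (hτB : φ τB = τ)
  (hstar : ∀ b : E × K, (J : Matrix (Fin 3) (Fin 3) E) * φ (RingHom.prodMap σ σK b) = ((φ b).map σ)ᵀ * J)

omit [ValuativeRel E] in
include hK hφ hτB hstar in
/-- **`⟨x₀, x₀⟩_J ≠ 0` for `x₀ = φ(1,0)·w₀`**: by the adjoint (`hstar`) `⟨φ(m)w₀, J·x₀⟩ = σ(m₁)·⟨x₀, x₀⟩` for every `m`, the `φ(m)w₀` exhaust `E³` (cyclicity), and `J` is invertible —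
so `⟨x₀, x₀⟩ = 0` would force `J x₀ = 0`, `x₀ = 0`, `(1,0) = 0`. [cite: Jacobowitz1962, §4] [cite: HornJohnson2013, §3.2.4] -/
theorem pairing_map_one_zero_ne_zero :
    dotProduct (fun i => σ ((φ ((1, 0) : E × K) *ᵥ w₀) i)) ((J : Matrix (Fin 3) (Fin 3) E) *ᵥ (φ ((1, 0) : E × K) *ᵥ w₀)) ≠ 0 := by
  intro hd
  set x₀ : Fin 3 → E := φ ((1, 0) : E × K) *ᵥ w₀ with hx₀
  -- `⟨φ(m) w₀, J x₀⟩ = 0` for every `m`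
  have horth : ∀ m : E × K, dotProduct (fun i => σ ((φ m *ᵥ w₀) i)) ((J : Matrix (Fin 3) (Fin 3) E) *ᵥ x₀) = 0 := by
    intro m
    have h := pairing_mul_smul_idem_fst σ σK J φ (w₀ := w₀) hstar m 1 1
    rw [mul_one, one_smul, one_mul] at h
    rw [hx₀, h, hd, mul_zero]
  -- hence `J x₀ = 0`
  have hJx : (J : Matrix (Fin 3) (Fin 3) E) *ᵥ x₀ = 0 := by
    funext i
    obtain ⟨m, hm⟩ := exists_map_mulVec_eq τ hK φ τB hτB (Pi.single i (1 : E))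
    have h := horth m
    rw [hm] at h
    have hsingle : (fun k => σ (Pi.single (M := fun _ : Fin 3 => E) i (1 : E) k)) = Pi.single i (1 : E) := by
      funext k
      by_cases hk : k = i
      · subst hk; simp
      · simp [Pi.single_eq_of_ne hk]
    rw [hsingle, single_one_dotProduct] at h
    exact h
  have hx0 : x₀ = 0 := by
    have h := congrArg (fun y => ((J⁻¹ : GL (Fin 3) E) : Matrix (Fin 3) (Fin 3) E) *ᵥ y) hJx
    simpa only [Matrix.mulVec_mulVec, ← Units.val_mul, inv_mul_cancel, Units.val_one, Matrix.one_mulVec, Matrix.mulVec_zero] using h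
  have h10 : ((1, 0) : E × K) = 0 := eq_zero_of_map_mulVec_eq_zero τ hK φ hφ τB hτB (by rw [← hx₀, hx0])
  exact one_ne_zero (congrArg Prod.fst h10)

variable (cfr : GL (Fin 3) E) (φb : (Matrix (Fin 2) (Fin 2) E × E) →ₐ[E] Matrix (Fin 3) (Fin 3) E)
  (hφb : ∀ (g : Matrix (Fin 2) (Fin 2) E) (u : E),
    φb (g, u) = (cfr : Matrix (Fin 3) (Fin 3) E) * Matrix.reindex endoPerm endoPerm (Matrix.fromBlocks g 0 0 (u • (1 : Matrix (Fin 1) (Fin 1) E))) *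
      ((cfr⁻¹ : GL (Fin 3) E) : Matrix (Fin 3) (Fin 3) E))

omit [ValuativeRel E] in
/-- The `e₁`-column of `[0 ⊕ 1]` vanishes: `[0 ⊕ 1] *ᵥ e₁ = 0` (`e₁ = Pi.single (endoPerm (inl 0)) 1`). [cite: HornJohnson2013, §1.3] -/
theorem reindex_fromBlocks_zero_one_mulVec_single_inl :
    Matrix.reindex endoPerm endoPerm (Matrix.fromBlocks (0 : Matrix (Fin 2) (Fin 2) E) 0 0 ((1 : E) • (1 : Matrix (Fin 1) (Fin 1) E))) *ᵥ
        Pi.single (endoPerm (Sum.inl 0)) (1 : E) = 0 := by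
  rw [Matrix.mulVec_single_one]
  ext i
  simp only [Matrix.col_apply, Matrix.reindex_apply, Matrix.submatrix_apply, Equiv.symm_apply_apply, Pi.zero_apply]
  obtain ⟨x, rfl⟩ := endoPerm.surjective i
  rw [Equiv.symm_apply_apply]
  rcases x with a | b
  · rw [Matrix.fromBlocks_apply₁₁, Matrix.zero_apply]
  · rw [Matrix.fromBlocks_apply₂₁, Matrix.zero_apply]

omit [ValuativeRel E] in
include hφb in
/-- **`φ′(1,0)·w₀ = x₀`**: for the endoscopic frame `φ′` of a block frame (`φ′(s, p + qλ) = φ(p•1 + q•g, s)`, ★ `algHom_prod_apply_eq_blockFrame`) and the Krylov vector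
`w₀ = c·(e₁ + e₂)` of ★ (c5-ii) FILE B, the idempotent `(1,0)` maps `w₀` to the frame vector `x₀ = c·e₂`. [cite: HornJohnson2013, §1.3] -/
theorem map_one_zero_mulVec_krylovVector (g : Matrix (Fin 2) (Fin 2) E) (u : E) (hirr : ∀ x : E, x * x - g.trace * x + g.det ≠ 0) {lam : K}
    (hlam : lam ^ 2 - algebraMap E K g.trace * lam + algebraMap E K g.det = 0) (hφx : φ ((u, lam) : E × K) = φb (g, u))
    (hall : ∀ b : E × K, ∃ P : E[X], aeval ((u, lam) : E × K) P = b) :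
    φ ((1, 0) : E × K) *ᵥ ((cfr : Matrix (Fin 3) (Fin 3) E) *ᵥ (Pi.single (endoPerm (Sum.inl 0)) (1 : E) + Pi.single (endoPerm (Sum.inr 0)) (1 : E))) =
      (cfr : Matrix (Fin 3) (Fin 3) E) *ᵥ Pi.single (endoPerm (Sum.inr 0)) (1 : E) := by
  have h10 : ((1, 0) : E × K) = ((1, algebraMap E K 0 + algebraMap E K 0 * lam) : E × K) := by simp
  have hφ1 : φ ((1, 0) : E × K) = φb ((0 : E) • (1 : Matrix (Fin 2) (Fin 2) E) + (0 : E) • g, 1) := by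
    rw [h10]; exact algHom_prod_apply_eq_blockFrame φb g u hirr hlam φ hφx hall 1 0 0
  have hcc : ((cfr⁻¹ : GL (Fin 3) E) : Matrix (Fin 3) (Fin 3) E) * (cfr : Matrix (Fin 3) (Fin 3) E) = 1 := by
    rw [← Units.val_mul, inv_mul_cancel, Units.val_one]
  rw [hφ1, zero_smul, zero_smul, add_zero, hφb, Matrix.mulVec_mulVec, Matrix.mul_assoc ((cfr : Matrix (Fin 3) (Fin 3) E) * _), hcc, Matrix.mul_one,
    ← Matrix.mulVec_mulVec, Matrix.mulVec_add, reindex_fromBlocks_zero_one_mulVec_single_inl, zero_add,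
    reindex_fromBlocks_mulVec_single (0 : Matrix (Fin 2) (Fin 2) E) (1 : E), one_smul]

end Frame

/-! ## §2 Krylov ↔ `Λ_O` at a generator: `Λ_{incl 𝒪_E[x′]}(w) = ⊕_k 𝒪·(φ′(incl x′))^k·w` -/

section Krylov

variable {E : Type*} [Field E] [ValuativeRel E] {K : Type*} [Field K] [ValuativeRel K] [Algebra E K]
  (φ : (E × K) →ₐ[E] Matrix (Fin 3) (Fin 3) E)
  (jO : 𝒪[E] →+* 𝒪[K]) (hjO : ∀ x : 𝒪[E], ((jO x : 𝒪[K]) : K) = algebraMap E K x)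

include hjO in
/-- `incl ∘ (id, jO) = algebraMap 𝒪_E (E × K)` (coercions). [cite: HornJohnson2013, §3.2.4] -/
theorem prodMap_subtype_comp_prod_eq :
    (RingHom.prodMap (𝒪[E]).subtype (𝒪[K]).subtype).comp (RingHom.prod (RingHom.id 𝒪[E]) jO) = algebraMap 𝒪[E] (E × K) := by
  refine RingHom.ext fun c => Prod.ext ?_ ?_
  · rfl
  · change ((jO c : 𝒪[K]) : K) = (algebraMap 𝒪[E] (E × K) c).2
    rw [hjO, Prod.algebraMap_apply]
    rfl

include hjO in
/-- **KRYLOV ↔ `Λ_O`**: for `x′ ∈ 𝒪_E × 𝒪_K` with `τ′ := φ′(incl x′)` of INTEGRAL characteristic polynomial, the `incl 𝒪_E[x′]`-cyclic lattice through `w` is the Krylov lattice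
`⊕_{k<3} 𝒪·τ′^k·w` — ★ F3-2a `span_image_mulVec_eq_span_range_pow_mulVec_of_adjoin` with `𝒪[τ′] = φ′(incl 𝒪_E[x′])` (`φ′ ∘ incl ∘ eval₂ = aeval τ′` on `𝒪_E[X]`).
[cite: HornJohnson2013, §3.2.4] [cite: Jacobowitz1962, §7] -/
theorem span_image_eq_span_range_pow_of_generator (x' : 𝒪[E] × 𝒪[K])
    (hint : ∀ i, (φ (RingHom.prodMap (𝒪[E]).subtype (𝒪[K]).subtype x')).charpoly.coeff i ∈ 𝒪[E]) (w : Fin 3 → E) :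
    Submodule.span 𝒪[E] ((fun x : E × K => φ x *ᵥ w) ''
        (((Polynomial.eval₂RingHom (RingHom.prod (RingHom.id 𝒪[E]) jO) x').range.map (RingHom.prodMap (𝒪[E]).subtype (𝒪[K]).subtype) : Subring (E × K)) :
          Set (E × K))) =
      Submodule.span 𝒪[E] (Set.range fun k : Fin 3 => ((φ (RingHom.prodMap (𝒪[E]).subtype (𝒪[K]).subtype x')) ^ (k : ℕ)) *ᵥ w) := by
  set incl : 𝒪[E] × 𝒪[K] →+* E × K := RingHom.prodMap (𝒪[E]).subtype (𝒪[K]).subtype with hincl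
  set τ' : Matrix (Fin 3) (Fin 3) E := φ (incl x') with hτ'
  -- `φ′ ∘ incl ∘ eval₂ (id, jO) x′ = aeval τ′` on `𝒪_E[X]`
  have hcomp : ((φ : (E × K) →+* Matrix (Fin 3) (Fin 3) E).comp incl).comp (RingHom.prod (RingHom.id 𝒪[E]) jO) = algebraMap 𝒪[E] (Matrix (Fin 3) (Fin 3) E) := by
    rw [RingHom.comp_assoc, prodMap_subtype_comp_prod_eq jO hjO]
    refine RingHom.ext fun c => ?_
    rw [RingHom.comp_apply, IsScalarTower.algebraMap_apply 𝒪[E] E (E × K), RingHom.coe_coe, AlgHom.commutes, ← IsScalarTower.algebraMap_apply]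
  have heval : ∀ P : Polynomial 𝒪[E], φ (incl (Polynomial.eval₂RingHom (RingHom.prod (RingHom.id 𝒪[E]) jO) x' P)) = aeval τ' P := by
    intro P
    have h1 : incl (P.eval₂ (RingHom.prod (RingHom.id 𝒪[E]) jO) x') = P.eval₂ (incl.comp (RingHom.prod (RingHom.id 𝒪[E]) jO)) (incl x') :=
      Polynomial.hom_eval₂ P _ incl x'
    have h2 : (φ : (E × K) →+* Matrix (Fin 3) (Fin 3) E) (P.eval₂ (incl.comp (RingHom.prod (RingHom.id 𝒪[E]) jO)) (incl x')) =
        P.eval₂ (((φ : (E × K) →+* Matrix (Fin 3) (Fin 3) E).comp incl).comp (RingHom.prod (RingHom.id 𝒪[E]) jO)) (φ (incl x')) := by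
      rw [RingHom.comp_assoc]; exact Polynomial.hom_eval₂ P _ (φ : (E × K) →+* Matrix (Fin 3) (Fin 3) E) (incl x')
    rw [Polynomial.coe_eval₂RingHom, h1, ← RingHom.coe_coe φ, h2, hcomp, Polynomial.aeval_def]
  refine span_image_mulVec_eq_span_range_pow_mulVec_of_adjoin τ' hint φ ((Polynomial.eval₂RingHom (RingHom.prod (RingHom.id 𝒪[E]) jO) x').range.map incl) (fun x => ?_) w
  rw [Algebra.adjoin_singleton_eq_range_aeval, AlgHom.mem_range]
  constructor
  · rintro ⟨P, rfl⟩
    exact ⟨incl (Polynomial.eval₂RingHom (RingHom.prod (RingHom.id 𝒪[E]) jO) x' P), Subring.mem_map.2 ⟨_, ⟨P, rfl⟩, rfl⟩, heval P⟩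
  · rintro ⟨b, hb, rfl⟩
    obtain ⟨z, ⟨P, rfl⟩, rfl⟩ := Subring.mem_map.1 hb
    exact ⟨P, (heval P).symm⟩

end Krylov

/-! ## §3 The integral `Λ_O`-currency gate from the `Valued`∕Krylov-currency gate at a block frame -/

section Gate

variable {F E : Type*} [Field F] [ValuativeRel F] [Field E] [Valued E ℤᵐ⁰] [ValuativeRel E] [(Valued.v : Valuation E ℤᵐ⁰).Compatible]
  (σ : E →+* E) {K : Type*} [Field K] [Valued K ℤᵐ⁰] [ValuativeRel K] [Algebra E K] (σK : K →+* K)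
  -- ★ F3-2b ∕ F3-2a's endoscopic frame, the Krylov vector being ★ (c5-ii) FILE B's `w₀ = c·(e₁ + e₂)`
  (hσσ : ∀ x, σ (σ x) = x) (hσK : ∀ x, σK (σK x) = x) (hσO : ∀ x : 𝒪[E], σ x ∈ 𝒪[E]) (hK2 : Module.finrank E K = 2)
  (J : GL (Fin 3) E) (hJ : J ∈ glInt 3 E) (hJh : ((J : Matrix (Fin 3) (Fin 3) E).map σ)ᵀ = J)
  (cfr : GL (Fin 3) E) (τ : Matrix (Fin 3) (Fin 3) E)
  (hK : IsUnit (Matrix.of fun i j : Fin 3 => ((τ ^ (j : ℕ)) *ᵥ ((cfr : Matrix (Fin 3) (Fin 3) E) *ᵥ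
    (Pi.single (endoPerm (Sum.inl 0)) (1 : E) + Pi.single (endoPerm (Sum.inr 0)) (1 : E)))) i).det)
  (φ : (E × K) →ₐ[E] Matrix (Fin 3) (Fin 3) E) (hφ : Function.Injective φ) (τB : E × K) (hτB : φ τB = τ)
  (hstar : ∀ b : E × K, (J : Matrix (Fin 3) (Fin 3) E) * φ (RingHom.prodMap σ σK b) = ((φ b).map σ)ᵀ * J)
  -- ★ (c4)'s integral reading, and `σ_K` over `σ`
  (hOK : ∀ r : 𝒪[E], algebraMap E K (r : E) ∈ 𝒪[K]) (hσKE : ∀ x : E, σK (algebraMap E K x) = algebraMap E K (σ x))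
  (jO : 𝒪[E] →+* 𝒪[K]) (hjO : ∀ x : 𝒪[E], ((jO x : 𝒪[K]) : K) = algebraMap E K x)
  (σO : 𝒪[E] →+* 𝒪[E]) (hσO' : ∀ x : 𝒪[E], ((σO x : 𝒪[E]) : E) = σ x)
  (σKO : 𝒪[K] →+* 𝒪[K]) (hσKO : ∀ z : 𝒪[K], ((σKO z : 𝒪[K]) : K) = σK z)
  (hσv : ∀ x, valuation E (σ x) = valuation E x) (hσKv : ∀ z, valuation K (σK z) = valuation K z)
  -- ★ F3-3 ∕ F3-1a's Eisenstein letters over the inert dictionary, at `O₁ := 𝒪[K]`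
  (ιO : 𝒪[F] →+* 𝒪[E]) (θ : 𝒪[K]) {aF k₀F : 𝒪[F]}
  (hσι : ∀ y, σO (ιO y) = ιO y) (hfixO : ∀ x, σO x = x → ∃ y, ιO y = x) (hιinj : Function.Injective ιO) (hιu : ∀ y, IsUnit (ιO y) → IsUnit y)
  (htr : ∃ b₀ : 𝒪[E], b₀ + σO b₀ = 1)
  (hσ₁j : ∀ x, σKO (jO x) = jO (σO x)) (hσ₁θ : σKO θ = θ)
  (hθ : θ ^ 2 = jO (ιO aF) * θ + jO (ιO k₀F)) (haF : aF ∈ IsLocalRing.maximalIdeal 𝒪[F]) (hk₀ : k₀F ∈ IsLocalRing.maximalIdeal 𝒪[F])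
  (hcoord : ∀ z : 𝒪[K], ∃! bc : 𝒪[E] × 𝒪[E], z = jO bc.1 + jO bc.2 * θ)
  (hnormE : ∀ b : 𝒪[E], IsUnit b → σO b = b → ∃ c : 𝒪[E], c * σO c = b) (hnorm₁ : ∀ z : 𝒪[K], IsUnit z → σKO z = z → ∃ w : 𝒪[K], w * σKO w = z)
  {ϖF : F} {ϖ : E} (hϖF : IsUniformizingElement ϖF) (hϖ : IsUniformizingElement ϖ) (hιϖ : ιO ⟨ϖF, hϖF.mem⟩ = ⟨ϖ, hϖ.mem⟩)
  (hk₁ : valuation E ((ιO k₀F : 𝒪[E]) : E) = valuation E ϖ) (hq : Nat.card 𝓀[E] = Nat.card 𝓀[F] ^ 2)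
  {ξ : 𝒪[E]} (hξ : IsUnit (ξ - σO ξ))
  (hnormEb : ∀ b : ℕ, 1 ≤ b → ∀ r : 𝒪[E], σO r = r → r - 1 ∈ Ideal.span ({(⟨ϖ, hϖ.mem⟩ : 𝒪[E]) ^ b} : Set 𝒪[E]) →
    ∃ w : 𝒪[E], w - 1 ∈ Ideal.span ({(⟨ϖ, hϖ.mem⟩ : 𝒪[E]) ^ b} : Set 𝒪[E]) ∧ w * σO w = r)
  -- the `Valued` letters of ★ (c10b-S3-A)
  (hσvV : ∀ x, Valued.v (σ x) = Valued.v x) (hjv : ∀ y : E, Valued.v (algebraMap E K y) = Valued.v y ^ 2)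
  (hθv : Valued.v (θ : K) = WithZero.exp (-1 : ℤ)) (hϖv : Valued.v ϖ = WithZero.exp (-1 : ℤ))
  (hcoordK : ∀ z : K, ∃! pq : E × E, z = algebraMap E K pq.1 + algebraMap E K pq.2 * (θ : K))
  (hnormK : ∀ x c : K, c ≠ 0 → σK c = c → Valued.v (x * σK x) = Valued.v c → ∃ t : K, t * σK t = c)
  -- the form's self-dual root and transitivity (★ (c2)'s letters)
  (hL₀ : IsSelfDualLattice σ ϖ (J : Matrix (Fin 3) (Fin 3) E) (stdLattice E 3))
  (htrans : ∀ M : Submodule (Valued.integer E) (Fin 3 → E), IsSelfDualLattice σ ϖ (J : Matrix (Fin 3) (Fin 3) E) M →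
    ∃ u : ↥(unitaryGroupOfForm σ (J : Matrix (Fin 3) (Fin 3) E)), M = mapGL ((u : ↥(unitaryGroupOfForm σ (J : Matrix (Fin 3) (Fin 3) E))) : GL (Fin 3) E) (stdLattice E 3))
  -- the type-(2) order `𝒪_E[x_R] = G(N, n, ιO y)` over `τ_B = incl x_R` at a monogenic level (★ FILE D ∕ D′'s output letters)
  (xR : 𝒪[E] × 𝒪[K]) (hxR : RingHom.prodMap (𝒪[E]).subtype (𝒪[K]).subtype xR = τB) {N n : ℕ} {y : 𝒪[F]}
  (hR : ((Polynomial.eval₂RingHom (RingHom.prod (RingHom.id 𝒪[E]) jO) xR).range : Set (𝒪[E] × 𝒪[K])) =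
    {z : 𝒪[E] × 𝒪[K] | ∃ b₀ c₀ : 𝒪[E], z.2 = jO b₀ + jO c₀ * (jO ((⟨ϖ, hϖ.mem⟩ : 𝒪[E]) ^ N) * θ) ∧
      z.1 - (b₀ + c₀ * ιO y) ∈ Ideal.span {(⟨ϖ, hϖ.mem⟩ : 𝒪[E]) ^ n}})
  (hlvl : (n = 2 * N + 1 ∧ y ∈ Ideal.span {(⟨ϖF, hϖF.mem⟩ : 𝒪[F]) ^ (N + 1)}) ∨
    ∃ M : ℕ, M ≤ N ∧ n = 2 * M ∧ y ∈ Ideal.span {(⟨ϖF, hϖF.mem⟩ : 𝒪[F]) ^ M} ∧ y ∉ Ideal.span {(⟨ϖF, hϖF.mem⟩ : 𝒪[F]) ^ (M + 1)})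
  -- the BLOCK FRAME presenting `φ′` (★ (c5-i) ∕ (c5-ii) FILE B ∕ (c8)-cor letters): `φ′(u, λ) = φ(g, u)`, `E × K = E[(u, λ)]`
  (φb : (Matrix (Fin 2) (Fin 2) E × E) →ₐ[E] Matrix (Fin 3) (Fin 3) E)
  (hφb : ∀ (g : Matrix (Fin 2) (Fin 2) E) (u : E),
    φb (g, u) = (cfr : Matrix (Fin 3) (Fin 3) E) * Matrix.reindex endoPerm endoPerm (Matrix.fromBlocks g 0 0 (u • (1 : Matrix (Fin 1) (Fin 1) E))) *
      ((cfr⁻¹ : GL (Fin 3) E) : Matrix (Fin 3) (Fin 3) E))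
  (g : Matrix (Fin 2) (Fin 2) E) (u : E) (hirr : ∀ x : E, x * x - g.trace * x + g.det ≠ 0) {lam : K}
  (hlam : lam ^ 2 - algebraMap E K g.trace * lam + algebraMap E K g.det = 0)
  (hφx : φ ((u, lam) : E × K) = φb (g, u)) (hall : ∀ b : E × K, ∃ P : E[X], aeval ((u, lam) : E × K) P = b)
  (hcoordlam : ∀ z : K, ∃ p q : E, z = algebraMap E K p + algebraMap E K q * lam)
  -- THE GATE in `Valued`∕Krylov currency (= the common conclusion of ★ (c8)-cor `gate_at_generator_uniform` ∕ `_wildUnit`, their generator data as antecedents)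
  (hgateV : ∀ (u' p' q' t' D' : E) (N'' b : ℕ),
    ((u', algebraMap E K p' + algebraMap E K q' * (θ : K)) : E × K) * RingHom.prodMap σ σK ((u', algebraMap E K p' + algebraMap E K q' * (θ : K)) : E × K) = 1 →
    Valued.v (u' - 1) < 1 → Valued.v (p' - 1) < 1 → Valued.v q' = WithZero.exp (-(N'' : ℤ)) →
    (algebraMap E K p' + algebraMap E K q' * (θ : K)) ^ 2 - algebraMap E K t' * (algebraMap E K p' + algebraMap E K q' * (θ : K)) + algebraMap E K D' = 0 →
    Valued.v (u' * u' - t' * u' + D') = WithZero.exp (-(b : ℤ)) →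
    ((∃ w : Fin 3 → E, ∃ g₁ ∈ unitaryGroupOfForm σ (J : Matrix (Fin 3) (Fin 3) E),
      Submodule.span 𝒪[E] (Set.range fun k : Fin 3 =>
        ((φ ((u', algebraMap E K p' + algebraMap E K q' * (θ : K)) : E × K)) ^ (k : ℕ)) *ᵥ w) =
        Submodule.span 𝒪[E] (Set.range ((g₁ : Matrix (Fin 3) (Fin 3) E))ᵀ)) ↔
    Even (WithZero.log (Valued.v (∑ k, ∑ i, σ (((cfr : Matrix (Fin 3) (Fin 3) E) *ᵥ Pi.single (endoPerm (Sum.inr 0)) (1 : E)) i) *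
      (J : Matrix (Fin 3) (Fin 3) E) i k * ((cfr : Matrix (Fin 3) (Fin 3) E) *ᵥ Pi.single (endoPerm (Sum.inr 0)) (1 : E)) k)) + b)))

omit [Valued K ℤᵐ⁰] in
include hK hφ hτB hstar hjO hσO' hσKO hσvV hϖv hcoordK hφb hirr hlam hφx hall hcoordlam hgateV in
/-- **THE INTEGRAL `Λ_O`-CURRENCY GATE FROM THE `Valued`∕KRYLOV-CURRENCY GATE.**  For a class index `cls ∈ {0,1}` with `cls = 0 ⟺` the `E`-line `x₀ = φ′(1,0)·w₀` is of class I,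
★ F3-5b-I's binder `hgate` holds at every deep unitary generator `x′ = (u′, jO p′ + jO q′ θ)` with INTEGRAL letters: coerce along `hjO hσO′ hσKO` (`𝔪 = {v < 1}`, `valuation = vϖ^N
⇒ Valued.v = exp(−N)`), apply `hgateV`, trade the Krylov lattice for `Λ_{incl 𝒪_E[x′]}` (§2, the characteristic polynomial `(X − u′)(X² − t′X + D′)` of `τ′ = φ′(incl x′)` being integral
because the two quadratics of `λ′ ∉ E` agree), and read `Even (log|⟨x₀,x₀⟩| + b)` as `b ≡ cls` through §1. [cite: Rogawski1990, §4.9 Lemma 4.9.3 p. 56] [cite: Jacobowitz1962, §7 Thm. 7.1] -/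
theorem gate_integral_of_gate_valued (cls : ℕ) (hcls : cls = 0 ∨ cls = 1)
    (hclsI : (∃ c : E, c ≠ 0 ∧ valuation E (σ c * c *
      dotProduct (fun i => σ ((φ ((1, 0) : E × K) *ᵥ ((cfr : Matrix (Fin 3) (Fin 3) E) *ᵥ
        (Pi.single (endoPerm (Sum.inl 0)) (1 : E) + Pi.single (endoPerm (Sum.inr 0)) (1 : E)))) i))
        ((J : Matrix (Fin 3) (Fin 3) E) *ᵥ (φ ((1, 0) : E × K) *ᵥ ((cfr : Matrix (Fin 3) (Fin 3) E) *ᵥ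
          (Pi.single (endoPerm (Sum.inl 0)) (1 : E) + Pi.single (endoPerm (Sum.inr 0)) (1 : E)))))) = 1) ↔ cls = 0) :
    ∀ (N'' b : ℕ) (u' p' q' t' D' : 𝒪[E]), 1 ≤ b →
      ((u', jO p' + jO q' * θ) : 𝒪[E] × 𝒪[K]) * RingHom.prodMap σO σKO (u', jO p' + jO q' * θ) = 1 →
      u' - 1 ∈ IsLocalRing.maximalIdeal 𝒪[E] → p' - 1 ∈ IsLocalRing.maximalIdeal 𝒪[E] → 1 - t' + D' ∈ IsLocalRing.maximalIdeal 𝒪[E] →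
      (jO p' + jO q' * θ) ^ 2 - jO t' * (jO p' + jO q' * θ) + jO D' = 0 →
      valuation E ((q' : 𝒪[E]) : E) = valuation E ϖ ^ N'' →
      valuation E ((u' * u' - t' * u' + D' : 𝒪[E]) : E) = valuation E ϖ ^ b →
      ((∃ w : Fin 3 → E, ∃ g₁ ∈ unitaryGroupOfForm σ (J : Matrix (Fin 3) (Fin 3) E),
          Submodule.span 𝒪[E] ((fun x : E × K => φ x *ᵥ w) ''
            (((Polynomial.eval₂RingHom (RingHom.prod (RingHom.id 𝒪[E]) jO) ((u', jO p' + jO q' * θ) : 𝒪[E] × 𝒪[K])).range.map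
              (RingHom.prodMap (𝒪[E]).subtype (𝒪[K]).subtype) : Subring (E × K)) : Set (E × K))) =
          Submodule.span 𝒪[E] (Set.range ((g₁ : Matrix (Fin 3) (Fin 3) E))ᵀ)) ↔ b % 2 = cls) := by
  intro N'' b u' p' q' t' D' _ hunit hu1 hp1 _ hquad hN hbv
  set incl : 𝒪[E] × 𝒪[K] →+* E × K := RingHom.prodMap (𝒪[E]).subtype (𝒪[K]).subtype with hincl
  set x'O : 𝒪[E] × 𝒪[K] := (u', jO p' + jO q' * θ) with hx'O
  set lamE : K := algebraMap E K (p' : E) + algebraMap E K (q' : E) * (θ : K) with hlamE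
  -- ### 1. integral → field currency
  have hlamcoe : ((jO p' + jO q' * θ : 𝒪[K]) : K) = lamE := by rw [Subring.coe_add, Subring.coe_mul, hjO, hjO]
  have hx'coe : incl x'O = (((u' : E), lamE) : E × K) := Prod.ext rfl hlamcoe
  have hunitE : (((u' : E), lamE) : E × K) * RingHom.prodMap σ σK (((u' : E), lamE) : E × K) = 1 := by
    have h := congrArg incl hunit
    have hstarcoe : incl (RingHom.prodMap σO σKO x'O) = RingHom.prodMap σ σK (incl x'O) := Prod.ext (hσO' _) (hσKO _)
    rw [map_mul, map_one, hstarcoe, hx'coe] at h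
    exact h
  have hmax : ∀ x : 𝒪[E], x ∈ IsLocalRing.maximalIdeal 𝒪[E] → Valued.v (x : E) < 1 := fun x hx =>
    (v_lt_one_iff_valuation_lt_one _).2 (valuation_coe_lt_one_of_mem_maximalIdeal hx)
  have hu1E : Valued.v ((u' : E) - 1) < 1 := by simpa using hmax _ hu1
  have hp1E : Valued.v ((p' : E) - 1) < 1 := by simpa using hmax _ hp1
  have hpow : ∀ (x : 𝒪[E]) (m : ℕ), valuation E (x : E) = valuation E ϖ ^ m → Valued.v (x : E) = WithZero.exp (-(m : ℤ)) := by
    intro x m h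
    have h' : Valued.v (x : E) = Valued.v (ϖ ^ m) := valued_v_eq_of_valuation_eq (by rw [map_pow]; exact h)
    rw [h', map_pow, hϖv, ← WithZero.exp_nsmul, smul_neg, nsmul_eq_mul, mul_one]
  have hqE : Valued.v (q' : E) = WithZero.exp (-(N'' : ℤ)) := hpow q' N'' hN
  have hbE : Valued.v ((u' : E) * u' - t' * u' + D') = WithZero.exp (-(b : ℤ)) := by simpa using hpow _ b hbv
  have hquadE : lamE ^ 2 - algebraMap E K (t' : E) * lamE + algebraMap E K (D' : E) = 0 := by
    have h := congrArg (fun z : 𝒪[K] => (z : K)) hquad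
    simp only [Subring.coe_add, AddSubgroupClass.coe_sub, Subring.coe_mul, SubmonoidClass.coe_pow, ZeroMemClass.coe_zero, hjO] at h
    exact h
  -- ### 2. the `Valued`∕Krylov gate
  have hV := hgateV (u' : E) (p' : E) (q' : E) (t' : E) (D' : E) N'' b hunitE hu1E hp1E hqE hquadE hbE
  -- ### 3. the characteristic polynomial of `τ′ = φ′(incl x′)` is `(X − u′)(X² − t′X + D′)`, integral
  obtain ⟨p, q, hpq⟩ := hcoordlam lamE
  have hφx' : φ (((u' : E), lamE) : E × K) = φb (p • (1 : Matrix (Fin 2) (Fin 2) E) + q • g, (u' : E)) := by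
    rw [hpq]; exact algHom_prod_apply_eq_blockFrame φb g u hirr hlam φ hφx hall (u' : E) p q
  have hq1 : lamE ^ 2 - algebraMap E K (p • (1 : Matrix (Fin 2) (Fin 2) E) + q • g).trace * lamE +
      algebraMap E K (p • (1 : Matrix (Fin 2) (Fin 2) E) + q • g).det = 0 := by
    rw [hpq]; exact quad_of_coord g hlam p q
  have hq'0 : (q' : E) ≠ 0 := fun h0 => by
    have h := hqE; rw [h0, map_zero] at h; exact WithZero.exp_ne_zero h.symm
  have htD : (p • (1 : Matrix (Fin 2) (Fin 2) E) + q • g).trace = (t' : E) ∧ (p • (1 : Matrix (Fin 2) (Fin 2) E) + q • g).det = (D' : E) := by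
    set A : E := (p • (1 : Matrix (Fin 2) (Fin 2) E) + q • g).trace with hA
    set B : E := (p • (1 : Matrix (Fin 2) (Fin 2) E) + q • g).det with hB
    have hdiff : algebraMap E K (A - t') * lamE = algebraMap E K (B - D') := by
      rw [map_sub, map_sub]; linear_combination hquadE - hq1
    by_cases hAt : A = (t' : E)
    · refine ⟨hAt, ?_⟩
      rw [hAt, sub_self, map_zero, zero_mul, eq_comm, map_sub, sub_eq_zero] at hdiff
      exact (algebraMap E K).injective hdiff
    · exfalso
      have hne : algebraMap E K (A - t') ≠ 0 := (_root_.map_ne_zero _).2 (sub_ne_zero.2 hAt)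
      have hlamE' : lamE = algebraMap E K ((B - D') / (A - t')) := by
        rw [map_div₀, eq_div_iff hne, mul_comm]; exact hdiff
      -- `λ′ ∈ E` contradicts `q′ ≠ 0`
      obtain ⟨pq, -, huniq⟩ := hcoordK lamE
      have h1 : ((p' : E), (q' : E)) = pq := huniq ((p' : E), (q' : E)) rfl
      have h2 : ((B - D') / (A - t'), (0 : E)) = pq :=
        huniq _ (show lamE = algebraMap E K ((B - D') / (A - t')) + algebraMap E K 0 * (θ : K) by rw [map_zero, zero_mul, add_zero]; exact hlamE')
      exact hq'0 (by have := congrArg Prod.snd (h1.trans h2.symm); exact this)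
  have hint : ∀ i, (φ (incl x'O)).charpoly.coeff i ∈ 𝒪[E] := by
    have hmap : (φ (incl x'O)).charpoly = Polynomial.map (algebraMap 𝒪[E] E) ((X ^ 2 - C t' * X + C D') * (X - C u')) := by
      rw [hx'coe, hφx', charpoly_blockFrame cfr φb hφb, Matrix.charpoly_fin_two, htD.1, htD.2]
      simp only [Polynomial.map_mul, Polynomial.map_sub, Polynomial.map_add, Polynomial.map_pow, Polynomial.map_X, Polynomial.map_C]
      rfl
    intro i
    rw [hmap, Polynomial.coeff_map]
    exact Subtype.mem _
  -- ### 4. Krylov ↔ `Λ_O`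
  have hKry := fun w => span_image_eq_span_range_pow_of_generator φ jO hjO x'O hint w
  have hLHS : (∃ w : Fin 3 → E, ∃ g₁ ∈ unitaryGroupOfForm σ (J : Matrix (Fin 3) (Fin 3) E),
        Submodule.span 𝒪[E] ((fun x : E × K => φ x *ᵥ w) ''
          (((Polynomial.eval₂RingHom (RingHom.prod (RingHom.id 𝒪[E]) jO) x'O).range.map incl : Subring (E × K)) : Set (E × K))) =
          Submodule.span 𝒪[E] (Set.range ((g₁ : Matrix (Fin 3) (Fin 3) E))ᵀ)) ↔
      (∃ w : Fin 3 → E, ∃ g₁ ∈ unitaryGroupOfForm σ (J : Matrix (Fin 3) (Fin 3) E),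
        Submodule.span 𝒪[E] (Set.range fun k : Fin 3 => ((φ (((u' : E), lamE) : E × K)) ^ (k : ℕ)) *ᵥ w) =
          Submodule.span 𝒪[E] (Set.range ((g₁ : Matrix (Fin 3) (Fin 3) E))ᵀ)) := by
    constructor
    · rintro ⟨w, g₁, hg₁, h⟩
      refine ⟨w, g₁, hg₁, ?_⟩
      rw [← hx'coe, ← hKry w]; exact h
    · rintro ⟨w, g₁, hg₁, h⟩
      refine ⟨w, g₁, hg₁, ?_⟩
      rw [hKry w, hx'coe]; exact h
  rw [hLHS, hV]
  -- ### 5. parity: `⟨x₀,x₀⟩ ≠ 0`, `φ′(1,0)·w₀ = x₀`, the class dictionary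
  have hx₀ := map_one_zero_mulVec_krylovVector φ cfr φb hφb g u hirr hlam hφx hall
  have hd₀ := pairing_map_one_zero_ne_zero σ σK J τ hK φ hφ τB hτB hstar
  rw [hx₀] at hd₀ hclsI
  have hsum : (∑ k, ∑ i, σ (((cfr : Matrix (Fin 3) (Fin 3) E) *ᵥ Pi.single (endoPerm (Sum.inr 0)) (1 : E)) i) *
      (J : Matrix (Fin 3) (Fin 3) E) i k * ((cfr : Matrix (Fin 3) (Fin 3) E) *ᵥ Pi.single (endoPerm (Sum.inr 0)) (1 : E)) k) =
      dotProduct (fun i => σ (((cfr : Matrix (Fin 3) (Fin 3) E) *ᵥ Pi.single (endoPerm (Sum.inr 0)) (1 : E)) i))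
        ((J : Matrix (Fin 3) (Fin 3) E) *ᵥ ((cfr : Matrix (Fin 3) (Fin 3) E) *ᵥ Pi.single (endoPerm (Sum.inr 0)) (1 : E))) := by
    simp only [dotProduct, Matrix.mulVec, Finset.mul_sum]
    rw [Finset.sum_comm]
    exact Finset.sum_congr rfl fun i _ => Finset.sum_congr rfl fun k _ => by ring
  rw [hsum]
  have hdict := exists_valuation_norm_mul_eq_one_iff_even_log σ hσvV hϖv hd₀
  rw [Int.even_add, Int.even_coe_nat, Nat.even_iff]
  rcases hcls with rfl | rfl
  · have hev : Even (WithZero.log (Valued.v _)) := hdict.1 (hclsI.2 rfl)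
    exact ⟨fun h => h.1 hev, fun h => ⟨fun _ => h, fun _ => hev⟩⟩
  · have hnev : ¬ Even (WithZero.log (Valued.v (dotProduct (fun i => σ (((cfr : Matrix (Fin 3) (Fin 3) E) *ᵥ Pi.single (endoPerm (Sum.inr 0)) (1 : E)) i))
        ((J : Matrix (Fin 3) (Fin 3) E) *ᵥ ((cfr : Matrix (Fin 3) (Fin 3) E) *ᵥ Pi.single (endoPerm (Sum.inr 0)) (1 : E)))))) :=
      fun h => absurd (hclsI.1 (hdict.2 h)) one_ne_zero
    constructor
    · intro h
      have h0 : ¬ b % 2 = 0 := fun h0 => hnev (h.2 h0)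
      omega
    · intro h; exact ⟨fun hev => absurd hev hnev, fun h0 => by omega⟩

/-! ## §4 The TREE-currency count at a block frame -/

include hσσ hσK hσO hK2 hJ hJh hK hφ hτB hstar hOK hσKE hjO hσO' hσKO hσv hσKv hσι hfixO hιinj hιu htr hσ₁j hσ₁θ hθ haF hk₀ hcoord hnormE hnorm₁ hιϖ hk₁ hq hξ hnormEb
  hσvV hjv hθv hϖv hcoordK hnormK hL₀ htrans hxR hR hlvl hφb hirr hlam hφx hall hcoordlam hgateV in
/-- **CLASS I AT A BLOCK FRAME — `#{M | IsSelfDualLattice σ ϖ J M ∧ τ·M ⊆ M} = phiTHn q n N`** with NO integral gate binder left: ★ F3-5b-III-α + §3 (`cls := 0`); the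
gate enters only as `hgateV` (★ (c8)-cor `gate_at_generator_uniform ∕ _wildUnit`'s conclusion, row-agnostic). [cite: Rogawski1990, §4.9 Lemma 4.9.3 p. 56, Prop. 4.9.1 (b) p. 55]
[cite: Jacobowitz1962, §7 Thm. 7.1] -/
theorem ncard_isSelfDualLattice_stable_eq_phiTHn_blockFrame [Finite 𝓀[F]] [Finite 𝓀[E]] [IsDiscreteValuationRing 𝒪[E]] [IsDiscreteValuationRing 𝒪[F]]
    (hI : ∃ c : E, c ≠ 0 ∧ valuation E (σ c * c *
      dotProduct (fun i => σ (((cfr : Matrix (Fin 3) (Fin 3) E) *ᵥ Pi.single (endoPerm (Sum.inr 0)) (1 : E)) i))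
        ((J : Matrix (Fin 3) (Fin 3) E) *ᵥ ((cfr : Matrix (Fin 3) (Fin 3) E) *ᵥ Pi.single (endoPerm (Sum.inr 0)) (1 : E)))) = 1) :
    (({M : Submodule (Valued.integer E) (Fin 3 → E) | IsSelfDualLattice σ ϖ (J : Matrix (Fin 3) (Fin 3) E) M ∧
        M.map ((Matrix.toLin' τ).restrictScalars (Valued.integer E)) ≤ M}.ncard : ℕ) : ℚ) = phiTHn (Nat.card 𝓀[F]) n N := by
  have hx₀ := map_one_zero_mulVec_krylovVector φ cfr φb hφb g u hirr hlam hφx hall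
  have hI' := hI
  rw [← hx₀] at hI'
  exact ncard_isSelfDualLattice_stable_eq_phiTHn σ σK hσσ hσK hσO hK2 J hJ hJh τ hK φ hφ τB hτB hstar hOK hσKE jO hjO σO hσO' σKO hσKO hσv hσKv ιO θ hσι hfixO hιinj
    hιu htr hσ₁j hσ₁θ hθ haF hk₀ hcoord hnormE hnorm₁ hϖF hϖ hιϖ hk₁ hq hξ hnormEb hσvV hjv hθv hϖv hcoordK hnormK hL₀ htrans xR hxR hR hlvl 0
    (gate_integral_of_gate_valued σ σK J cfr τ hK φ hφ τB hτB hstar jO hjO σO hσO' σKO hσKO θ hσvV hϖv hcoordK φb hφb g u hirr hlam hφx hall hcoordlam hgateV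
      0 (Or.inl rfl) ⟨fun _ => rfl, fun _ => hI'⟩)
    rfl hI'

omit [Valued K ℤᵐ⁰] in
include hσσ hσK hσO hK2 hJ hJh hK hφ hτB hstar hOK hσKE hjO hσO' hσKO hσv hσKv hσι hfixO hιinj hιu htr hσ₁j hσ₁θ hθ haF hk₀ hcoord hnormE hnorm₁ hιϖ hk₁ hq hξ hnormEb
  hσvV hϖv hcoordK hL₀ htrans hxR hR hlvl hφb hirr hlam hφx hall hcoordlam hgateV in
/-- **CLASS II AT A BLOCK FRAME — `#{M | IsSelfDualLattice σ ϖ J M ∧ τ·M ⊆ M} = phiTHprimen q n N`** (`cls := 1`; no product-order witness needed). [cite: Rogawski1990, §4.9 Lemma 4.9.3 p. 56, Prop. 4.9.1 (b) p. 55]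
[cite: Jacobowitz1962, §7 Thm. 7.1] -/
theorem ncard_isSelfDualLattice_stable_eq_phiTHprimen_blockFrame [Finite 𝓀[F]] [Finite 𝓀[E]] [IsDiscreteValuationRing 𝒪[E]] [IsDiscreteValuationRing 𝒪[F]]
    (hII : ∀ c : E, c ≠ 0 → valuation E (σ c * c *
      dotProduct (fun i => σ (((cfr : Matrix (Fin 3) (Fin 3) E) *ᵥ Pi.single (endoPerm (Sum.inr 0)) (1 : E)) i))
        ((J : Matrix (Fin 3) (Fin 3) E) *ᵥ ((cfr : Matrix (Fin 3) (Fin 3) E) *ᵥ Pi.single (endoPerm (Sum.inr 0)) (1 : E)))) ≠ 1) :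
    (({M : Submodule (Valued.integer E) (Fin 3 → E) | IsSelfDualLattice σ ϖ (J : Matrix (Fin 3) (Fin 3) E) M ∧
        M.map ((Matrix.toLin' τ).restrictScalars (Valued.integer E)) ≤ M}.ncard : ℕ) : ℚ) = phiTHprimen (Nat.card 𝓀[F]) n N := by
  have hx₀ := map_one_zero_mulVec_krylovVector φ cfr φb hφb g u hirr hlam hφx hall
  have hII' := hII
  rw [← hx₀] at hII'
  exact ncard_isSelfDualLattice_stable_eq_phiTHprimen σ σK hσσ hσK hσO hK2 J hJ hJh τ hK φ hφ τB hτB hstar hOK hσKE jO hjO σO hσO' σKO hσKO hσv hσKv ιO θ hσι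
    hfixO hιinj hιu htr hσ₁j hσ₁θ hθ haF hk₀ hcoord hnormE hnorm₁ hϖF hϖ hιϖ hk₁ hq hξ hnormEb hL₀ htrans xR hxR hR hlvl 1
    (gate_integral_of_gate_valued σ σK J cfr τ hK φ hφ τB hτB hstar jO hjO σO hσO' σKO hσKO θ hσvV hϖv hcoordK φb hφb g u hirr hlam hφx hall hcoordlam hgateV
      1 (Or.inr rfl) ⟨fun ⟨c, hc, h1⟩ => absurd h1 (hII' c hc), fun h => absurd h one_ne_zero⟩)
    rfl hII'

end Gate

end Literature.NumberTheory.Automorphic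

end
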